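import Summits.Ventures.Crystal3D.Theorems.StickyWulffConstantGenericWallFloorStackWalkRigidity
import Summits.Ventures.Crystal3D.Theorems.StickyWulffConstantGenericWallFloorCoaxialIff
import Summits.Ventures.Crystal3D.Theorems.StickyWulffConstantGenericWallFloorDoubleStarCoaxial
import Summits.Ventures.Crystal3D.Theorems.StickyWulffConstantGenericWallFloorChainTerminalClass
import Summits.Ventures.Crystal3D.Theorems.StickyWulffConstantCoaxialWallLawForeignTilt
import HarnessLib

/-!
# Coincident walk ends of one grain have NON-CO-AXIAL top lattices (crux `GenericWallFloor`, line
# `WallLedgerG`; third brick of the MERGE LOCALISATION of the stack ledger's residual `LOST`)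

HONEST FRAMING. Part of the venture `Summits/Ventures/Crystal3D` (cell `crystal3d-full`), helper
`--supports` the crux `GenericWallFloor` (stmt-Ventures-19480) of `route-Ventures-StickyWulffConstant`,
registered line `WallLedgerG`, open stub `stub_twoSlabAdhesion` (general fillings).  Sequel of
`…StackWalkReverse` / `…StackWalkRigidity`.  Two DIFFERENT states `(y, stack₁)`, `(y, stack₂)` of one grain's
stack walk at the SAME ball `y` (the only way the end-ball map can fail to be injective once the end-STATE map
is injective) have top frames whose linear lattices are NOT co-axial — so the certified input
`DoubleStarCoaxialAt` (R39d) prices them exactly like the double tops of the chain ledger: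

* `stack_adjacent_of_twin_image` — if the top slot dozen of stack₂ is the mirror image of stack₁'s across a
  menu normal of stack₁'s top frame, one stack is the other with one more level (`Σ3`-adjacent; NonReturn).
* `false_of_star_of_twin_predecessor` (LEMMA C) — a ball owning the closed `F`-star of `−v` (`v` positive for
  the menu normal `m`) has no neighbour at `y − G c` for the twin `G = R_m F` and any `m`-positive `G`-slot `c`:
  the two candidates lie in the two triangles of the hexagram one layer below `y` (`…StackWalkReverse`), at
  distance `1/√3` from `y − F v` or from a star ball.  (Seat numerics `calc/sigma3_double_end.py`: 0 of 600
  discrete configurations feasible.)  Hence `Σ3`-adjacent stacks never certify the same ball.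
* `image_negConst_eq_reflection_image`, `image_fccSlots_eq_of_image_fcc_eq` — the mirror stacking `Λ₀⁻` is
  the `e₃`-reflection of `Λ₀`; equal lattices have equal slot dozens.
* **`not_coaxial_of_two_states`** — for two sound, well-formed, certified states of one grain (same bottom
  entry) at one ball: different stacks ⇒ the top frames' lattices are not co-axial (`twin_of_coaxial_of_ne`:
  co-axial different lattices are mirror twins ⇒ `Σ3`-adjacent ⇒ LEMMA C; equal lattices ⇒ equal stacks by
  `stack_eq_of_image_eq`).

WHAT THIS IS NOT: not the stub; the injectivity of `top ↦ end state` and the per-ball pricing are the next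
bricks; `ExactOnly` (C12-55) and `DoubleStarCoaxialAt` stay inputs of the ledger; F-C1 not moved.
-/

noncomputable section

namespace Summit.Ventures.Crystal3D.Theorems

open Finset
open Literature.MathematicalPhysics.StatisticalMechanics (fccStacking barlowStacking IsHaggSeq)
open scoped InnerProductSpace

variable {X : Finset (EuclideanSpace ℝ (Fin 3))}

/-! ### Σ3-adjacency of stacks with mirror-image top dozens -/

/-- A reduced one-letter extension: for unit model menu normals `μ ≠ ±μ′`, `⟪μ, μ′⟫ = ±1/3`. -/
theorem rel_of_reflection_ne {μ μ' : EuclideanSpace ℝ (Fin 3)} (hμ : ‖μ‖ = 1) (hμ' : ‖μ'‖ = 1)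
    (hm : ∀ w ∈ fccSlots, ⟪w, μ⟫_ℝ = 0 ∨ ⟪w, μ⟫_ℝ = Real.sqrt (2 / 3) ∨ ⟪w, μ⟫_ℝ = -Real.sqrt (2 / 3))
    (hm' : ∀ w ∈ fccSlots, ⟪w, μ'⟫_ℝ = 0 ∨ ⟪w, μ'⟫_ℝ = Real.sqrt (2 / 3) ∨ ⟪w, μ'⟫_ℝ = -Real.sqrt (2 / 3))
    (hR : (ℝ ∙ μ)ᗮ.reflection ≠ (ℝ ∙ μ')ᗮ.reflection) : ⟪μ, μ'⟫_ℝ = 1 / 3 ∨ ⟪μ, μ'⟫_ℝ = -1 / 3 := by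
  have hmx : ∀ w ∈ fccSlots,
      ⟪(LinearIsometryEquiv.refl ℝ (EuclideanSpace ℝ (Fin 3))) w, μ⟫_ℝ = 0 ∨
      ⟪(LinearIsometryEquiv.refl ℝ (EuclideanSpace ℝ (Fin 3))) w, μ⟫_ℝ = Real.sqrt (2 / 3) ∨
      ⟪(LinearIsometryEquiv.refl ℝ (EuclideanSpace ℝ (Fin 3))) w, μ⟫_ℝ = -Real.sqrt (2 / 3) := by
    intro w hw; simpa using hm w hw
  have hmy : ∀ w ∈ fccSlots,
      ⟪(LinearIsometryEquiv.refl ℝ (EuclideanSpace ℝ (Fin 3))) w, μ'⟫_ℝ = 0 ∨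
      ⟪(LinearIsometryEquiv.refl ℝ (EuclideanSpace ℝ (Fin 3))) w, μ'⟫_ℝ = Real.sqrt (2 / 3) ∨
      ⟪(LinearIsometryEquiv.refl ℝ (EuclideanSpace ℝ (Fin 3))) w, μ'⟫_ℝ = -Real.sqrt (2 / 3) := by
    intro w hw; simpa using hm' w hw
  rcases inner_menuNormals (LinearIsometryEquiv.refl ℝ _) hμ hμ' hmx hmy with h | h | h | h
  · have hxy : μ = μ' := (inner_eq_one_iff_of_norm_eq_one (𝕜 := ℝ) hμ hμ').1 h
    subst hxy; exact absurd rfl hR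
  · have hyx : μ' = -μ := eq_neg_of_inner_eq_neg_one' hμ hμ' h
    subst hyx; exact absurd (reflection_neg_eq hμ).symm hR
  · exact Or.inl h
  · exact Or.inr h

/-- Letters of a one-letter extension `μ :: κ` of a word with good letters. -/
theorem letters_cons {μ : EuclideanSpace ℝ (Fin 3)} {κ : List (EuclideanSpace ℝ (Fin 3))}
    (hμ : ‖μ‖ = 1 ∧ ∀ w ∈ fccSlots, ⟪w, μ⟫_ℝ = 0 ∨ ⟪w, μ⟫_ℝ = Real.sqrt (2 / 3) ∨ ⟪w, μ⟫_ℝ = -Real.sqrt (2 / 3))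
    (hl : ∀ ν ∈ κ, ‖ν‖ = 1 ∧
      ∀ w ∈ fccSlots, ⟪w, ν⟫_ℝ = 0 ∨ ⟪w, ν⟫_ℝ = Real.sqrt (2 / 3) ∨ ⟪w, ν⟫_ℝ = -Real.sqrt (2 / 3)) :
    ∀ ν ∈ μ :: κ, ‖ν‖ = 1 ∧
      ∀ w ∈ fccSlots, ⟪w, ν⟫_ℝ = 0 ∨ ⟪w, ν⟫_ℝ = Real.sqrt (2 / 3) ∨ ⟪w, ν⟫_ℝ = -Real.sqrt (2 / 3) := by
  intro ν hν
  rcases List.mem_cons.1 hν with rfl | h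
  · exact hμ
  · exact hl ν h

/-- **Σ3-adjacency.**  Two sound well-formed stacks with the same bottom entry; if the slot dozen of the second
top frame is that of the TWIN of the first top frame across a unit menu normal `m`, then one stack is the
other with exactly one more level. -/
theorem stack_adjacent_of_twin_image {z : EuclideanSpace ℝ (Fin 3)} {e₁ e₂ : WalkEntry} {r₁ r₂ : List WalkEntry}
    (hS₁ : StackSound z (e₁ :: r₁)) (hW₁ : StackWF z (e₁ :: r₁)) (hS₂ : StackSound z (e₂ :: r₂))
    (hW₂ : StackWF z (e₂ :: r₂)) (hlast : (e₁ :: r₁).getLast? = (e₂ :: r₂).getLast?)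
    {m : EuclideanSpace ℝ (Fin 3)} (hm : ‖m‖ = 1)
    (hmenu : ∀ w ∈ fccSlots, ⟪e₁.frame w, m⟫_ℝ = 0 ∨ ⟪e₁.frame w, m⟫_ℝ = Real.sqrt (2 / 3) ∨
      ⟪e₁.frame w, m⟫_ℝ = -Real.sqrt (2 / 3))
    (himg : (e₂.frame : EuclideanSpace ℝ (Fin 3) → EuclideanSpace ℝ (Fin 3)) '' ↑fccSlots =
      (twinFrame e₁.frame m : EuclideanSpace ℝ (Fin 3) → EuclideanSpace ℝ (Fin 3)) '' ↑fccSlots) :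
    (∃ e, e₂ :: r₂ = e :: e₁ :: r₁) ∨ (∃ e, e₁ :: r₁ = e :: e₂ :: r₂) := by
  set B := stackBase (e₁ :: r₁) with hB
  have hbase : stackBase (e₂ :: r₂) = B := by rw [hB, stackBase_eq_getLast?, stackBase_eq_getLast?, hlast]
  obtain ⟨hl₁, hc₁⟩ := stackWord_letters _ hS₁ hW₁
  obtain ⟨hl₂, hc₂⟩ := stackWord_letters _ hS₂ hW₂
  set μ := e₁.frame.symm m with hμdef
  have hμ : ‖μ‖ = 1 ∧ ∀ w ∈ fccSlots, ⟪w, μ⟫_ℝ = 0 ∨ ⟪w, μ⟫_ℝ = Real.sqrt (2 / 3) ∨ ⟪w, μ⟫_ℝ = -Real.sqrt (2 / 3) := by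
    refine ⟨by rw [hμdef, LinearIsometryEquiv.norm_map, hm], fun w hw => ?_⟩
    rw [hμdef, ← LinearIsometryEquiv.inner_map_map e₁.frame, LinearIsometryEquiv.apply_symm_apply]
    exact hmenu w hw
  have hF₁ : e₁.frame = wordFrame B (stackWord (e₁ :: r₁)) := frame_eq_wordFrame e₁ r₁ hS₁
  have hF₂ : e₂.frame = wordFrame B (stackWord (e₂ :: r₂)) := by rw [← hbase]; exact frame_eq_wordFrame e₂ r₂ hS₂
  have htwin : twinFrame e₁.frame m = wordFrame B (μ :: stackWord (e₁ :: r₁)) := by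
    rw [wordFrame_cons, ← hF₁]; exact twinFrame_eq_reflection_trans e₁.frame hm
  have himg' : (wordFrame B (stackWord (e₂ :: r₂)) : EuclideanSpace ℝ (Fin 3) → EuclideanSpace ℝ (Fin 3)) '' ↑fccSlots =
      (wordFrame B (μ :: stackWord (e₁ :: r₁)) : EuclideanSpace ℝ (Fin 3) → EuclideanSpace ℝ (Fin 3)) '' ↑fccSlots := by
    rw [← hF₂, ← htwin]; exact himg
  cases r₁ with
  | nil =>
    -- `κ₁ = []`: the second word is the single letter `μ`
    have hmap := map_reflection_eq_of_image_eq B hl₂ hc₂ (letters_cons hμ hl₁) (by simp) himg'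
    cases r₂ with
    | nil => simp at hmap
    | cons e₂' r₂' =>
      cases r₂' with
      | cons _ _ => simp at hmap
      | nil =>
        left
        refine ⟨e₂, ?_⟩
        have : e₂' = e₁ := by simpa using hlast.symm
        rw [this]
  | cons e₁' r₁' =>
    by_cases hR : (ℝ ∙ μ)ᗮ.reflection = (ℝ ∙ (e₁'.frame.symm e₁.nrm))ᗮ.reflection
    · -- the extension cancels the top letter: the second stack is the first without its top
      right
      refine ⟨e₁, ?_⟩
      have hF₁' : e₁'.frame = wordFrame B (stackWord (e₁' :: r₁')) := frame_eq_wordFrame e₁' r₁' hS₁.2.2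
      have hcollapse : wordFrame B (μ :: stackWord (e₁ :: e₁' :: r₁')) = wordFrame B (stackWord (e₁' :: r₁')) := by
        rw [stackWord_cons_cons, wordFrame_cons, wordFrame_cons, hR]
        exact LinearIsometryEquiv.ext fun x => by simp [LinearIsometryEquiv.trans_apply, Submodule.reflection_reflection]
      rw [hcollapse, ← hF₁', ← hF₂] at himg'
      have hlast' : (e₂ :: r₂).getLast? = (e₁' :: r₁').getLast? := by rw [← hlast, List.getLast?_cons_cons]
      rw [stack_eq_of_image_eq hS₂ hW₂ hS₁.2.2 hW₁.2.2 hlast' himg']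
    · -- the extension is reduced: the second word is `μ :: κ₁`
      have hμt := hl₁ (e₁'.frame.symm e₁.nrm) (by simp)
      have hcμ : List.IsChain (fun μ μ' => ⟪μ, μ'⟫_ℝ = 1 / 3 ∨ ⟪μ, μ'⟫_ℝ = -1 / 3) (μ :: stackWord (e₁ :: e₁' :: r₁')) := by
        rw [stackWord_cons_cons, List.isChain_cons_cons, ← stackWord_cons_cons]
        exact ⟨rel_of_reflection_ne hμ.1 hμt.1 hμ.2 hμt.2 hR, hc₁⟩
      have hmap := map_reflection_eq_of_image_eq B hl₂ hc₂ (letters_cons hμ hl₁) hcμ himg'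
      cases r₂ with
      | nil => simp at hmap
      | cons e₂' r₂' =>
        rw [stackWord_cons_cons, List.map_cons, List.map_cons, List.cons.injEq] at hmap
        have hlast' : (e₂' :: r₂').getLast? = (e₁ :: e₁' :: r₁').getLast? := by rw [hlast, List.getLast?_cons_cons]
        have := stack_eq_of_map_stackWord_eq (e₂' :: r₂') (e₁ :: e₁' :: r₁') hS₂.2.2 hW₂.2.2 hS₁ hW₁ hlast' hmap.2
        left
        exact ⟨e₂, by rw [this]⟩

/-! ### LEMMA C: a star ball has no twin predecessor -/

/-- **LEMMA C (no `Σ3`-adjacent double end).**  `F` a frame, `m` a unit menu normal of `F`, `G = R_m F` its twin,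
`v` an `m`-positive `F`-slot, `c` an `m`-positive `G`-slot.  In a `1`-separated `X`, a ball `y` owning the
closed `F`-star of `−v` (`y − F v` and the four `y − F v + F w`, `⟪w, v⟫ = ½`) does not have `y − G c` in `X`. -/
theorem false_of_star_of_twin_predecessor (hX : ∀ p ∈ X, ∀ q ∈ X, p ≠ q → 1 ≤ dist p q)
    (F G : EuclideanSpace ℝ (Fin 3) ≃ₗᵢ[ℝ] EuclideanSpace ℝ (Fin 3)) {m : EuclideanSpace ℝ (Fin 3)} (hm : ‖m‖ = 1)
    (hmenu : ∀ w ∈ fccSlots, ⟪F w, m⟫_ℝ = 0 ∨ ⟪F w, m⟫_ℝ = Real.sqrt (2 / 3) ∨ ⟪F w, m⟫_ℝ = -Real.sqrt (2 / 3))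
    (hG : ∀ x, G x = F x - (2 * ⟪F x, m⟫_ℝ) • m)
    {v : EuclideanSpace ℝ (Fin 3)} (hv : v ∈ fccSlots) (hvm : ⟪F v, m⟫_ℝ = Real.sqrt (2 / 3))
    {y : EuclideanSpace ℝ (Fin 3)} (hstar₀ : y - F v ∈ X)
    (hstar : ∀ w ∈ fccSlots, ⟪w, v⟫_ℝ = 1 / 2 → y - F v + F w ∈ X)
    {c : EuclideanSpace ℝ (Fin 3)} (hc : c ∈ fccSlots) (hcm : ⟪G c, m⟫_ℝ = Real.sqrt (2 / 3))
    (hyc : y - G c ∈ X) : False := by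
  obtain ⟨h23, -⟩ := sqrt_twoThirds_facts
  have hrpos : 0 < Real.sqrt (2 / 3) := Real.sqrt_pos.2 (by norm_num)
  have hflip : ∀ x, ⟪G x, m⟫_ℝ = -⟪F x, m⟫_ℝ := inner_twin_eq_neg F G hm hG
  have hcF : ⟪F c, m⟫_ℝ = -Real.sqrt (2 / 3) := by have := hflip c; rw [hcm] at this; linarith
  have hGc : G c = F c + (2 * Real.sqrt (2 / 3)) • m := by rw [hG c, hcF]; module
  have hmm : ⟪m, m⟫_ℝ = 1 := by rw [real_inner_self_eq_norm_sq, hm, one_pow]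
  have hunit : ∀ {w}, w ∈ fccSlots → ⟪F w, F w⟫_ℝ = 1 := fun {w} hw => by
    rw [real_inner_self_eq_norm_sq, LinearIsometryEquiv.norm_map, norm_eq_one_of_mem_fccSlots hw, one_pow]
  by_cases hcv : c = -v
  · -- `y − G c = y + F v − 2√(2/3) m` is `1/√3` from the star ball `y − F v + F (v − u)`, `u ≠ v` positive
    subst hcv
    obtain ⟨u, hu, hum, huv⟩ := exists_pos_slot_ne F hm hmenu v
    have hvu : ⟪v, u⟫_ℝ = 1 / 2 :=
      inner_eq_half_of_pos_pos F hm hmenu hv hu (Ne.symm huv) (by rw [hvm]; exact hrpos) (by rw [hum]; exact hrpos)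
    have hw : v - u ∈ fccSlots := sub_mem_fccSlots_of_inner_eq_half hv hu hvu
    have hwv : ⟪v - u, v⟫_ℝ = 1 / 2 := by
      rw [inner_sub_left, real_inner_self_eq_norm_sq, norm_eq_one_of_mem_fccSlots hv, real_inner_comm, hvu]; norm_num
    have hb : y - F v + F (v - u) ∈ X := hstar _ hw hwv
    have ha : y + F v - (2 * Real.sqrt (2 / 3)) • m ∈ X := by
      have : y - G (-v) = y + F v - (2 * Real.sqrt (2 / 3)) • m := by rw [hGc, map_neg]; abel
      rw [← this]; exact hyc
    refine false_of_dist_sq_eq_third hX ha hb ?_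
    have e : (y + F v - (2 * Real.sqrt (2 / 3)) • m) - (y - F v + F (v - u)) =
        F v + F u - (2 * Real.sqrt (2 / 3)) • m := by rw [map_sub]; abel
    rw [dist_eq_norm, e, ← real_inner_self_eq_norm_sq]
    have hFvu : ⟪F v, F u⟫_ℝ = 1 / 2 := by rw [LinearIsometryEquiv.inner_map_map]; exact hvu
    have hFuv : ⟪F u, F v⟫_ℝ = 1 / 2 := by rw [real_inner_comm]; exact hFvu
    have hmv : ⟪m, F v⟫_ℝ = Real.sqrt (2 / 3) := by rw [real_inner_comm]; exact hvm
    have hmu : ⟪m, F u⟫_ℝ = Real.sqrt (2 / 3) := by rw [real_inner_comm]; exact hum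
    simp only [inner_add_left, inner_add_right, inner_sub_left, inner_sub_right, real_inner_smul_left,
      real_inner_smul_right, hunit hv, hunit hu, hmm, hFvu, hFuv, hmv, hmu, hvm, hum]
    nlinarith [h23]
  · -- `c ≠ −v`: `y − F v` and `y − G c` themselves are `1/√3` apart
    have hd : dist (y - F v) (y - G c) ^ 2 = -(2 / 3) - 2 * ⟪c, v⟫_ℝ := by
      have e : (y - F v) - (y - G c) = F c - F v + (2 * Real.sqrt (2 / 3)) • m := by rw [hGc]; abel
      rw [dist_eq_norm, e, ← real_inner_self_eq_norm_sq]
      have hFcv : ⟪F c, F v⟫_ℝ = ⟪c, v⟫_ℝ := by rw [LinearIsometryEquiv.inner_map_map]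
      have hFvc : ⟪F v, F c⟫_ℝ = ⟪c, v⟫_ℝ := by rw [real_inner_comm]; exact hFcv
      have hmv : ⟪m, F v⟫_ℝ = Real.sqrt (2 / 3) := by rw [real_inner_comm]; exact hvm
      have hmc : ⟪m, F c⟫_ℝ = -Real.sqrt (2 / 3) := by rw [real_inner_comm]; exact hcF
      simp only [inner_add_left, inner_add_right, inner_sub_left, inner_sub_right, real_inner_smul_left,
        real_inner_smul_right, hunit hv, hunit hc, hmm, hFcv, hFvc, hmv, hmc, hvm, hcF]
      nlinarith [h23]
    have hnonneg : 0 ≤ dist (y - F v) (y - G c) ^ 2 := sq_nonneg _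
    rcases inner_slots_mem hc hv with h | h | h | h | h
    · rw [h] at hd; linarith
    · rw [h] at hd; linarith
    · rw [h] at hd; linarith
    · rw [h] at hd
      exact false_of_dist_sq_eq_third hX hstar₀ hyc (by rw [hd]; norm_num)
    · exact hcv (by have := eq_neg_of_inner_eq_neg_one hc hv h; rw [this, neg_neg])

/-- **The closed star of a certified walker.**  A certified walker at `y` with top entry `e` (direction a slot)
owns the closed `e.frame`-star of `−e.dir`. -/
theorem star_of_walkCertified {y : EuclideanSpace ℝ (Fin 3)} {e : WalkEntry} (hdir : e.dir ∈ fccSlots)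
    (hC : WalkCertified X y e) :
    y - e.frame e.dir ∈ X ∧ ∀ w ∈ fccSlots, ⟪w, e.dir⟫_ℝ = 1 / 2 → y - e.frame e.dir + e.frame w ∈ X := by
  rcases hC with ⟨hd, hsh⟩ | ⟨n₀, hn₀, hmenu₀, hpos₀, hd, hocc₀⟩
  · exact ⟨hd, fun w hw _ => hsh w hw⟩
  · exact ⟨hd, fun w hw hadj => hocc₀ w hw (nonneg_of_adjacent_pos e.frame hn₀ hmenu₀ hdir hw hpos₀ hadj)⟩

/-- **Σ3-adjacent stacks never certify the same ball.**  If `e⁺ :: e :: rest` is sound and both the deeper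
state `(y, e⁺ :: e :: rest)` and the shallower `(y, e :: rest)` are certified at `y`, contradiction. -/
theorem false_of_adjacent_certified (hX : ∀ p ∈ X, ∀ q ∈ X, p ≠ q → 1 ≤ dist p q)
    {z y : EuclideanSpace ℝ (Fin 3)} {ep e : WalkEntry} {rest : List WalkEntry}
    (hS : StackSound z (ep :: e :: rest)) (hCp : WalkCertified X y ep) (hC : WalkCertified X y e) : False := by
  obtain ⟨hSo, hLi, hS'⟩ := hS
  obtain ⟨hdirp, hm, hmenup, hcm, -, -, -⟩ := hSo
  have hdir : e.dir ∈ fccSlots := hS'.top.1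
  have hF : ∀ x, e.frame x = ep.frame x - (2 * ⟪ep.frame x, ep.nrm⟫_ℝ) • ep.nrm := twin_symm e.frame ep.frame hm hLi.1
  have hmenu := menu_reflect ep.frame e.frame hm hmenup hF
  obtain ⟨h₀, hstar⟩ := star_of_walkCertified hdir hC
  obtain ⟨hp, -⟩ := star_of_walkCertified hdirp hCp
  exact false_of_star_of_twin_predecessor hX e.frame ep.frame hm hmenu hLi.1 hdir hLi.2 h₀ hstar hdirp hcm hp

/-! ### Lattices, slots and the mirror stacking -/

/-- Equal linear lattices have equal slot dozens. -/
theorem image_fccSlots_eq_of_image_fcc_eq (A B : EuclideanSpace ℝ (Fin 3) ≃ₗᵢ[ℝ] EuclideanSpace ℝ (Fin 3))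
    (h : A '' fccStacking 1 (Real.sqrt (2 / 3)) = B '' fccStacking 1 (Real.sqrt (2 / 3))) :
    (A : EuclideanSpace ℝ (Fin 3) → EuclideanSpace ℝ (Fin 3)) '' ↑fccSlots =
      (B : EuclideanSpace ℝ (Fin 3) → EuclideanSpace ℝ (Fin 3)) '' ↑fccSlots := by
  have key : ∀ (A B : EuclideanSpace ℝ (Fin 3) ≃ₗᵢ[ℝ] EuclideanSpace ℝ (Fin 3)),
      A '' fccStacking 1 (Real.sqrt (2 / 3)) = B '' fccStacking 1 (Real.sqrt (2 / 3)) →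
      (A : EuclideanSpace ℝ (Fin 3) → EuclideanSpace ℝ (Fin 3)) '' ↑fccSlots ⊆
        (B : EuclideanSpace ℝ (Fin 3) → EuclideanSpace ℝ (Fin 3)) '' ↑fccSlots := by
    intro A B h v hv
    obtain ⟨w, hw, rfl⟩ := hv
    rw [Finset.mem_coe] at hw
    have hmem : A w ∈ B '' fccStacking 1 (Real.sqrt (2 / 3)) := by rw [← h]; exact ⟨w, mem_fcc_of_mem_fccSlots hw, rfl⟩
    obtain ⟨w', hw', he⟩ := exists_slot_of_unit_mem B hmem
      (by rw [LinearIsometryEquiv.norm_map, norm_eq_one_of_mem_fccSlots hw])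
    exact ⟨w', Finset.mem_coe.2 hw', he⟩
  exact Set.Subset.antisymm (key A B h) (key B A h.symm)

/-- The horizontal mirror in coordinates. -/
theorem horizMirror_eq (x : EuclideanSpace ℝ (Fin 3)) :
    x - (2 * ⟪x, EuclideanSpace.single (2 : Fin 3) (1 : ℝ)⟫_ℝ) • EuclideanSpace.single (2 : Fin 3) (1 : ℝ) =
      !₂[x 0, x 1, -x 2] := by
  have hi : ⟪x, EuclideanSpace.single (2 : Fin 3) (1 : ℝ)⟫_ℝ = x 2 := by
    rw [EuclideanSpace.inner_single_right]; simp
  rw [hi]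
  ext l
  fin_cases l <;> simp [two_mul]

/-- **The mirror stacking is the `e₃`-reflection of `Λ₀`, moved**: `L·Λ₀⁻ = R_{Le₃}(L·Λ₀)`. -/
theorem image_negConst_eq_reflection_image (L : EuclideanSpace ℝ (Fin 3) ≃ₗᵢ[ℝ] EuclideanSpace ℝ (Fin 3)) :
    L '' barlowStacking 1 (Real.sqrt (2 / 3)) (fun _ : ℤ => (-1 : ℤ)) =
      (fun x => x - (2 * ⟪x, L (EuclideanSpace.single (2 : Fin 3) (1 : ℝ))⟫_ℝ) • L (EuclideanSpace.single (2 : Fin 3) (1 : ℝ))) ''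
        (L '' fccStacking 1 (Real.sqrt (2 / 3))) := by
  set e₃ : EuclideanSpace ℝ (Fin 3) := EuclideanSpace.single (2 : Fin 3) (1 : ℝ) with he₃
  have hH : ∀ x : EuclideanSpace ℝ (Fin 3), x - (2 * ⟪x, e₃⟫_ℝ) • e₃ = !₂[x 0, x 1, -x 2] := horizMirror_eq
  have hHH : ∀ x : EuclideanSpace ℝ (Fin 3), (x - (2 * ⟪x, e₃⟫_ℝ) • e₃) - (2 * ⟪x - (2 * ⟪x, e₃⟫_ℝ) • e₃, e₃⟫_ℝ) • e₃ = x :=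
    horizMirror_horizMirror
  ext p
  constructor
  · rintro ⟨q, hq, rfl⟩
    have hq' := (mem_barlowStacking_negConst_iff (Real.sqrt (2 / 3)) q).1 hq
    rw [← hH] at hq'
    refine ⟨L (q - (2 * ⟪q, e₃⟫_ℝ) • e₃), ⟨_, hq', rfl⟩, ?_⟩
    show L (q - (2 * ⟪q, e₃⟫_ℝ) • e₃) - (2 * ⟪L (q - (2 * ⟪q, e₃⟫_ℝ) • e₃), L e₃⟫_ℝ) • L e₃ = L q
    rw [mirror_conj, hHH]
  · rintro ⟨_, ⟨q, hq, rfl⟩, rfl⟩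
    refine ⟨q - (2 * ⟪q, e₃⟫_ℝ) • e₃, ?_, ?_⟩
    · rw [mem_barlowStacking_negConst_iff, ← hH, hHH]; exact hq
    · show L (q - (2 * ⟪q, e₃⟫_ℝ) • e₃) = L q - (2 * ⟪L q, L e₃⟫_ℝ) • L e₃
      rw [mirror_conj]

/-! ### The localisation: two states of one grain at one ball -/

/-- **Two different certified states of one grain at the same ball have non-co-axial top lattices.**  Sound,
well-formed stacks with the same bottom entry, both certified at `y` in the `1`-separated `X`; if the stacks
differ, the linear lattices of the two top frames are NOT co-axial. -/
theorem not_coaxial_of_two_states (hX : ∀ p ∈ X, ∀ q ∈ X, p ≠ q → 1 ≤ dist p q)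
    {z y : EuclideanSpace ℝ (Fin 3)} {e₁ e₂ : WalkEntry} {r₁ r₂ : List WalkEntry}
    (hS₁ : StackSound z (e₁ :: r₁)) (hW₁ : StackWF z (e₁ :: r₁)) (hC₁ : WalkCertified X y e₁)
    (hS₂ : StackSound z (e₂ :: r₂)) (hW₂ : StackWF z (e₂ :: r₂)) (hC₂ : WalkCertified X y e₂)
    (hlast : (e₁ :: r₁).getLast? = (e₂ :: r₂).getLast?) (hne : e₁ :: r₁ ≠ e₂ :: r₂) :
    ¬ ∃ (L : EuclideanSpace ℝ (Fin 3) ≃ₗᵢ[ℝ] EuclideanSpace ℝ (Fin 3))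
        (s₁ s₂ : EuclideanSpace ℝ (Fin 3)) (σ σ' : ℤ → ℤ), IsHaggSeq σ ∧ IsHaggSeq σ' ∧
        e₁.frame '' fccStacking 1 (Real.sqrt (2 / 3)) ⊆
          (fun p => L p + s₁) '' barlowStacking 1 (Real.sqrt (2 / 3)) σ ∧
        e₂.frame '' fccStacking 1 (Real.sqrt (2 / 3)) ⊆
          (fun p => L p + s₂) '' barlowStacking 1 (Real.sqrt (2 / 3)) σ' := by
  intro hco
  have haff := coaxial_affine_of_linear e₁.frame e₂.frame 0 0 hco
  have hfcc : fccStacking 1 (Real.sqrt (2 / 3)) = barlowStacking 1 (Real.sqrt (2 / 3)) (fun _ : ℤ => (1 : ℤ)) := rfl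
  -- equal lattices: equal stacks
  have hEq : e₁.frame '' fccStacking 1 (Real.sqrt (2 / 3)) ≠ e₂.frame '' fccStacking 1 (Real.sqrt (2 / 3)) := by
    intro h
    exact hne (stack_eq_of_image_eq hS₁ hW₁ hS₂ hW₂ hlast (image_fccSlots_eq_of_image_fcc_eq _ _ h))
  -- twin lattices: Σ3-adjacent stacks
  obtain ⟨L, hL⟩ := twin_of_coaxial_of_ne e₁.frame e₂.frame 0 0 haff hEq
  set e₃ : EuclideanSpace ℝ (Fin 3) := EuclideanSpace.single (2 : Fin 3) (1 : ℝ) with he₃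
  have he₃n : ‖e₃‖ = 1 := by rw [he₃, PiLp.norm_single, norm_one]
  have hm : ‖L e₃‖ = 1 := by rw [LinearIsometryEquiv.norm_map, he₃n]
  -- in both cases `e₂·Λ₀ = R_{Le₃}(e₁·Λ₀)` and `L e₃` is a menu normal of `e₁.frame`
  have key : e₂.frame '' fccStacking 1 (Real.sqrt (2 / 3)) =
      (fun x => x - (2 * ⟪x, L e₃⟫_ℝ) • L e₃) '' (e₁.frame '' fccStacking 1 (Real.sqrt (2 / 3))) ∧
      (e₁.frame '' fccStacking 1 (Real.sqrt (2 / 3)) = L '' fccStacking 1 (Real.sqrt (2 / 3)) ∨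
      e₁.frame '' fccStacking 1 (Real.sqrt (2 / 3)) = L '' barlowStacking 1 (Real.sqrt (2 / 3)) (fun _ : ℤ => (-1 : ℤ))) := by
    have hinv : ∀ S : Set (EuclideanSpace ℝ (Fin 3)),
        (fun x => x - (2 * ⟪x, L e₃⟫_ℝ) • L e₃) '' ((fun x => x - (2 * ⟪x, L e₃⟫_ℝ) • L e₃) '' S) = S := by
      intro S
      rw [Set.image_image]
      conv_rhs => rw [← Set.image_id S]
      refine Set.image_congr fun x _ => ?_
      have := reflect_reflect_unit hm x
      exact this
    rcases hL with ⟨h₁, h₂⟩ | ⟨h₁, h₂⟩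
    · exact ⟨by rw [h₂, image_negConst_eq_reflection_image, ← h₁], Or.inl h₁⟩
    · refine ⟨?_, Or.inr h₁⟩
      rw [h₁, image_negConst_eq_reflection_image, hinv, h₂]
  obtain ⟨hrel, hcase⟩ := key
  have hmenu : ∀ w ∈ fccSlots, ⟪e₁.frame w, L e₃⟫_ℝ = 0 ∨ ⟪e₁.frame w, L e₃⟫_ℝ = Real.sqrt (2 / 3) ∨
      ⟪e₁.frame w, L e₃⟫_ℝ = -Real.sqrt (2 / 3) := by
    have hLmenu : ∀ w ∈ fccSlots, ⟪L w, L e₃⟫_ℝ = 0 ∨ ⟪L w, L e₃⟫_ℝ = Real.sqrt (2 / 3) ∨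
        ⟪L w, L e₃⟫_ℝ = -Real.sqrt (2 / 3) := by
      intro w hw
      rw [LinearIsometryEquiv.inner_map_map, he₃, EuclideanSpace.inner_single_right]
      simpa using slot_apply_two_cases hw
    rcases hcase with h₁ | h₁
    · exact menu_of_image_eq L e₁.frame h₁.symm hLmenu
    · -- the twin lattice has the same menu for `L e₃`
      rw [image_negConst_eq_reflection_image] at h₁
      intro w hw
      have hmem : e₁.frame w ∈ (fun x => x - (2 * ⟪x, L e₃⟫_ℝ) • L e₃) '' (L '' fccStacking 1 (Real.sqrt (2 / 3))) := by
        rw [← h₁]; exact ⟨w, mem_fcc_of_mem_fccSlots hw, rfl⟩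
      obtain ⟨x', hx', he⟩ := hmem
      obtain ⟨q, hq, hqx⟩ := hx'
      rw [← hqx] at he
      dsimp only at he
      have hq1 : ‖q‖ = 1 := by
        have := congrArg norm he
        rw [LinearIsometryEquiv.norm_map, norm_eq_one_of_mem_fccSlots hw] at this
        rw [← this, ← reflection_unit_apply hm, LinearIsometryEquiv.norm_map, LinearIsometryEquiv.norm_map]
      rw [← he, ← reflection_unit_apply hm, inner_reflection_unit hm]
      rcases hLmenu q (mem_fccSlots_of_unit hq hq1) with h | h | h
      · left; rw [h, neg_zero]
      · right; right; rw [h]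
      · right; left; rw [h, neg_neg]
  -- slot images: `e₂.frame '' slots = twinFrame e₁.frame (L e₃) '' slots`
  have himg : (e₂.frame : EuclideanSpace ℝ (Fin 3) → EuclideanSpace ℝ (Fin 3)) '' ↑fccSlots =
      (twinFrame e₁.frame (L e₃) : EuclideanSpace ℝ (Fin 3) → EuclideanSpace ℝ (Fin 3)) '' ↑fccSlots := by
    apply image_fccSlots_eq_of_image_fcc_eq
    rw [hrel, Set.image_image]
    exact Set.image_congr fun x _ => (twinFrame_apply e₁.frame hm x).symm
  rcases stack_adjacent_of_twin_image hS₁ hW₁ hS₂ hW₂ hlast hm hmenu himg with ⟨e, he⟩ | ⟨e, he⟩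
  · injection he with hee hrr
    subst hrr; subst hee
    exact false_of_adjacent_certified hX hS₂ hC₂ hC₁
  · injection he with hee hrr
    subst hrr; subst hee
    exact false_of_adjacent_certified hX hS₁ hC₁ hC₂

end Summit.Ventures.Crystal3D.Theorems

end
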